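import Summits.ResolutionOfSingularities.ResolutionOfSingularities.Theorems.EquisingularLiftEquisingularLiftNatHilbertBurchLift
import Mathlib
import HarnessLib

/-!
# [OURS · L1 W4.5(b)] HILBERT–BURCH, PART 3 — THE DVR PACKAGING: `O[x]/I_t(M)` IS `O`-FLAT WITH SPECIAL FIBRE `k[x]/I_t(M̄)`
# FOR EVERY LIFT `M` OF A HILBERT–BURCH MATRIX `M̄` WHOSE REDUCED COMPLEX IS EXACT IN THE MIDDLE (rung v6′ «DET-nose»)
# (crux `EquisingularLiftNatThree` = stmt-ResolutionOfSingularities-20148, parent `EquisingularLiftNat` = stmt-20038,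
# line `sections`, research residue `stub_elnat_three_nonisolated_nonci`)

NOT a statement of any manuscript. Helper file of the chain res-L1-w45b (cell `res-hironaka`, rung L, slot W4.5(b));
AI-written, weaker than expert review; filed `--supports stmt-ResolutionOfSingularities-20148 --as helper`.

WHERE IT SITS (res-L1-w45b-lead-2 LEAD-MEMO-5 e186de0624463c55 §B rung v6′ «DET-nose» / §C DEALABLE (i) «maximal minors
of a lifted matrix generate an O-flat ideal when the reduction has grade 2», 2026-08-27T09:13:54Z). Parts 1–2
(`…NatHilbertBurchComplex.lean`, `…NatHilbertBurchLift.lean`) are pure commutative algebra over an arbitrary ring; this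
file specialises to the chain's currency: `O` a DVR with uniformizer `ϖ` (`Irreducible ϖ`), an `O`-algebra `A` in which
`ϖ` is a non-zero-divisor (e.g. `A = O[x_σ] = MvPolynomial σ O`), a surjection `f : A ↠ B` with `f ϖ = 0`,
`ker f ⊆ (ϖ)` (e.g. `f = MvPolynomial.map π` for a residue MODEL `π : O ↠ k`, `ker π = (ϖ)`, as in T-ΔLIFT p516044),
`M : Matrix (Fin (t+1)) (Fin t) A` with reduction `M̄ = M.map f`, `Δᵢ(M) = det (M.submatrix i.succAbove id)`,
`I_t(M) = Ideal.span (range Δ(M))`.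
* `isTorsionFree_of_forall_smul_eq_zero` — over a DVR, `ϖ`-torsion-free ⇒ torsion-free (every non-zero `r` is `u·ϖⁿ`).
* **`isTorsionFree_quotient_span_minor`**, **`flat_quotient_span_minor`** — if the reduced Hilbert–Burch complex of `M̄`
  is exact in the middle then `A ⧸ I_t(M)` is torsion-free, hence FLAT, over `O` (torsion-free over a Dedekind domain).
* `flat_quotient_span_minor_of_regular_pair` — the same from a regular pair `a, b ∈ I_t(M̄)` over `B` (grade ≥ 2).
* `ker_mvPolynomial_map_le_span_C`, `C_mem_nonZeroDivisors` — the MODEL hypotheses for `A = O[x_σ]`, `f = map π`.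
* **`flat_mvPolynomial_quotient_span_minor`** / **`_of_regular_pair`** + `map_span_minor_mvPolynomial` — THE v6′ RING
  CORE IN CHAIN CURRENCY: for `π : O ↠ k` with `ker π = (ϖ)` and `M` over `O[x_σ]` whose reduction `M̄ = M.map (map π)`
  over `k[x_σ]` has Hilbert–Burch complex exact in the middle (resp. a regular pair in `I_t(M̄)`),
  `Module.Flat O (O[x_σ] ⧸ I_t(M))` and `(I_t M).map (map π) = I_t(M̄)` (special fibre = the reduced determinantal
  scheme); `exists_matrix_map_mvPolynomial_eq` — every `M̄` has such a lift `M`.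

References: D. Eisenbud, *Commutative Algebra with a View Toward Algebraic Geometry* (GTM 150, 1995), §20; proofs
elementary, source not used. res-L1-w45b-lead-2 LEAD-MEMO-5 (OURS planning text, index only).
-/

set_option linter.dupNamespace false -- mandated namespace `Summit.<Summit>.<Problem>` of this single-conjunct summit
set_option linter.overlappingInstances false -- signatures carry both [IsDomain O] and [IsDiscreteValuationRing O] (Mathlib's class takes the former as a parameter)

namespace Summit.ResolutionOfSingularities.ResolutionOfSingularities.Cruxes.EquisingularLiftNat.Sections

open Matrix

universe u v w

/-! ## Torsion-freeness over a DVR from `ϖ`-torsion-freeness -/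

section DVR

variable {O : Type u} [CommRing O]

/-- Over a DVR with uniformizer `ϖ`, an `O`-module on which `ϖ` acts injectively is torsion-free (every non-zero
`r ∈ O` is `u · ϖⁿ` with `u` a unit). [folklore] [OURS · L1 W4.5b] -/
theorem isTorsionFree_of_forall_smul_eq_zero [IsDomain O] [IsDiscreteValuationRing O] {ϖ : O} (hϖ : Irreducible ϖ)
    {N : Type v} [AddCommGroup N] [Module O N] (h : ∀ m : N, ϖ • m = 0 → m = 0) : Module.IsTorsionFree O N := by
  have hpow : ∀ (n : ℕ) (m : N), ϖ ^ n • m = 0 → m = 0 := by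
    intro n
    induction n with
    | zero => intro m hm; simpa using hm
    | succ n ih =>
      intro m hm
      rw [pow_succ, mul_smul] at hm
      exact h m (ih (ϖ • m) hm)
  refine ⟨fun r hr => ?_⟩
  rw [isSMulRegular_iff_right_eq_zero_of_smul]
  intro m hm
  obtain ⟨n, v, rfl⟩ := IsDiscreteValuationRing.eq_unit_mul_pow_irreducible hr.ne_zero hϖ
  have hm' : ϖ ^ n • m = 0 := by
    have h2 := congrArg (fun x : N => ((v⁻¹ : Oˣ) : O) • x) hm
    simp only [smul_zero, smul_smul, ← mul_assoc, Units.inv_mul, one_mul] at h2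
    exact h2
  exact hpow n m hm'

variable {A : Type v} [CommRing A] [Algebra O A] {B : Type w} [CommRing B] {t : ℕ}

/-- **`A ⧸ I_t(M)` is torsion-free over the DVR.** `O` a DVR with uniformizer `ϖ`, `A` an `O`-algebra in which `ϖ` is a
non-zero-divisor, `f : A ↠ B` with `f ϖ = 0`, `ker f ⊆ (ϖ)`, `M : A^{(t+1) × t}` whose REDUCED Hilbert–Burch complex
(`M̄ = M.map f`) is exact in the middle. Then the `O`-module `A ⧸ I_t(M)` is torsion-free. [folklore, cf. Eisenbud GTM 150
§20] [OURS · L1 W4.5b] -/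
theorem isTorsionFree_quotient_span_minor [IsDomain O] [IsDiscreteValuationRing O] {ϖ : O} (hϖ : Irreducible ϖ)
    (hϖA : algebraMap O A ϖ ∈ nonZeroDivisors A) (f : A →+* B) (hf : Function.Surjective f)
    (hfϖ : f (algebraMap O A ϖ) = 0) (hker : ∀ x : A, f x = 0 → x ∈ Ideal.span {algebraMap O A ϖ})
    (M : Matrix (Fin (t + 1)) (Fin t) A)
    (hex : ∀ c : Fin (t + 1) → B,
      (Matrix.of fun i => (Fin.snoc ((M.map f) i) (c i) : Fin (t + 1) → B)).det = 0 →
        ∃ w : Fin t → B, (M.map f) *ᵥ w = c) :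
    Module.IsTorsionFree O (A ⧸ Ideal.span (Set.range fun i : Fin (t + 1) => (M.submatrix i.succAbove id).det)) := by
  apply isTorsionFree_of_forall_smul_eq_zero hϖ
  intro m hm
  obtain ⟨x, rfl⟩ := Ideal.Quotient.mk_surjective m
  rw [Algebra.smul_def, ← Ideal.Quotient.mk_algebraMap, ← map_mul, Ideal.Quotient.eq_zero_iff_mem] at hm
  exact Ideal.Quotient.eq_zero_iff_mem.mpr (mem_span_minor_of_mul_mem f hf hϖA hfϖ hker M hex hm)

/-- **`A ⧸ I_t(M)` is FLAT over the DVR** under the hypotheses of `isTorsionFree_quotient_span_minor` (torsion-free over a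
Dedekind domain is flat, Mathlib). [folklore, cf. Eisenbud GTM 150 §20] [OURS · L1 W4.5b] -/
theorem flat_quotient_span_minor [IsDomain O] [IsDiscreteValuationRing O] {ϖ : O} (hϖ : Irreducible ϖ)
    (hϖA : algebraMap O A ϖ ∈ nonZeroDivisors A) (f : A →+* B) (hf : Function.Surjective f)
    (hfϖ : f (algebraMap O A ϖ) = 0) (hker : ∀ x : A, f x = 0 → x ∈ Ideal.span {algebraMap O A ϖ})
    (M : Matrix (Fin (t + 1)) (Fin t) A)
    (hex : ∀ c : Fin (t + 1) → B,
      (Matrix.of fun i => (Fin.snoc ((M.map f) i) (c i) : Fin (t + 1) → B)).det = 0 →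
        ∃ w : Fin t → B, (M.map f) *ᵥ w = c) :
    Module.Flat O (A ⧸ Ideal.span (Set.range fun i : Fin (t + 1) => (M.submatrix i.succAbove id).det)) := by
  haveI := isTorsionFree_quotient_span_minor hϖ hϖA f hf hfϖ hker M hex
  infer_instance

/-- **Flatness from grade-two data downstairs**: as `flat_quotient_span_minor`, with the middle exactness of the reduced
complex replaced by a regular pair `a, b ∈ I_t(M.map f)` (`a` a non-zero-divisor of `B`, `b` one of `B/(a)`).
[Eisenbud GTM 150 Thm. 20.15 + §20; elementary proof OURS] [OURS · L1 W4.5b] -/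
theorem flat_quotient_span_minor_of_regular_pair [IsDomain O] [IsDiscreteValuationRing O] {ϖ : O}
    (hϖ : Irreducible ϖ) (hϖA : algebraMap O A ϖ ∈ nonZeroDivisors A) (f : A →+* B) (hf : Function.Surjective f)
    (hfϖ : f (algebraMap O A ϖ) = 0) (hker : ∀ x : A, f x = 0 → x ∈ Ideal.span {algebraMap O A ϖ})
    (M : Matrix (Fin (t + 1)) (Fin t) A) {a b : B}
    (haI : a ∈ Ideal.span (Set.range fun i : Fin (t + 1) => ((M.map f).submatrix i.succAbove id).det))
    (hbI : b ∈ Ideal.span (Set.range fun i : Fin (t + 1) => ((M.map f).submatrix i.succAbove id).det))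
    (ha : a ∈ nonZeroDivisors B) (hb : ∀ y : B, b * y ∈ Ideal.span {a} → y ∈ Ideal.span {a}) :
    Module.Flat O (A ⧸ Ideal.span (Set.range fun i : Fin (t + 1) => (M.submatrix i.succAbove id).det)) :=
  flat_quotient_span_minor hϖ hϖA f hf hfϖ hker M
    (fun c hc => exists_mulVec_eq_of_det_snoc_eq_zero (M.map f) haI hbI ha hb c hc)

end DVR

/-! ## The chain's currency: `A = O[x_σ]`, `f = MvPolynomial.map π` for a residue model `π : O ↠ k` -/

section Polynomial

open MvPolynomial

variable {O : Type u} [CommRing O] {k : Type v} [CommRing k] {σ : Type w} {t : ℕ}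

/-- For `π : O → k` with `ker π ⊆ (ϖ)`, the kernel of the coefficientwise map `O[x_σ] → k[x_σ]` lies in `(C ϖ)`.
[folklore] [OURS · L1 W4.5b] -/
theorem mem_span_C_of_map_eq_zero (π : O →+* k) {ϖ : O} (hker : ∀ r : O, π r = 0 → r ∈ Ideal.span {ϖ})
    (x : MvPolynomial σ O) (hx : MvPolynomial.map π x = 0) :
    x ∈ Ideal.span {(C ϖ : MvPolynomial σ O)} := by
  have h1 : x ∈ RingHom.ker (MvPolynomial.map (σ := σ) π) := hx
  rw [MvPolynomial.ker_map] at h1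
  have h2 : Ideal.map (C : O →+* MvPolynomial σ O) (RingHom.ker π) ≤ Ideal.span {(C ϖ : MvPolynomial σ O)} := by
    rw [Ideal.map_le_iff_le_comap]
    intro r hr
    obtain ⟨s, hs⟩ := Ideal.mem_span_singleton'.mp (hker r hr)
    exact Ideal.mem_comap.mpr (Ideal.mem_span_singleton'.mpr ⟨C s, by rw [← map_mul, hs]⟩)
  exact h2 h1

/-- `C ϖ` is a non-zero-divisor of `O[x_σ]` when `ϖ ≠ 0` and `O` is a domain. [folklore] [OURS · L1 W4.5b] -/
theorem C_mem_nonZeroDivisors [IsDomain O] {ϖ : O} (hϖ : ϖ ≠ 0) :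
    (C ϖ : MvPolynomial σ O) ∈ nonZeroDivisors (MvPolynomial σ O) :=
  mem_nonZeroDivisors_of_ne_zero (by rwa [Ne, MvPolynomial.C_eq_zero])

/-- **THE v6′ RING CORE IN CHAIN CURRENCY (torsion-free form).** `O` a DVR with uniformizer `ϖ`, `π : O ↠ k` a residue
model with `ker π ⊆ (ϖ)` and `π ϖ = 0`, `M` a `(t+1) × t` matrix over `O[x_σ]` whose reduction `M̄ = M.map (map π)` over
`k[x_σ]` has Hilbert–Burch complex exact in the middle. Then `O[x_σ] ⧸ I_t(M)` is torsion-free over `O`.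
[folklore, cf. Eisenbud GTM 150 §20] [OURS · L1 W4.5b] -/
theorem isTorsionFree_mvPolynomial_quotient_span_minor [IsDomain O] [IsDiscreteValuationRing O] {ϖ : O}
    (hϖ : Irreducible ϖ) (π : O →+* k) (hπ : Function.Surjective π) (hπϖ : π ϖ = 0)
    (hker : ∀ r : O, π r = 0 → r ∈ Ideal.span {ϖ}) (M : Matrix (Fin (t + 1)) (Fin t) (MvPolynomial σ O))
    (hex : ∀ c : Fin (t + 1) → MvPolynomial σ k,
      (Matrix.of fun i =>
          (Fin.snoc ((M.map (MvPolynomial.map π)) i) (c i) : Fin (t + 1) → MvPolynomial σ k)).det = 0 →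
        ∃ w : Fin t → MvPolynomial σ k, (M.map (MvPolynomial.map π)) *ᵥ w = c) :
    Module.IsTorsionFree O
      (MvPolynomial σ O ⧸ Ideal.span (Set.range fun i : Fin (t + 1) => (M.submatrix i.succAbove id).det)) := by
  have hA : algebraMap O (MvPolynomial σ O) ϖ = C ϖ := rfl
  refine isTorsionFree_quotient_span_minor hϖ ?_ (MvPolynomial.map π) (MvPolynomial.map_surjective π hπ) ?_ ?_ M hex
  · rw [hA]; exact C_mem_nonZeroDivisors hϖ.ne_zero
  · rw [hA, MvPolynomial.map_C, hπϖ, C_0]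
  · rw [hA]; exact mem_span_C_of_map_eq_zero π hker

/-- **THE v6′ RING CORE IN CHAIN CURRENCY (flatness).** Under the hypotheses of
`isTorsionFree_mvPolynomial_quotient_span_minor`, `O[x_σ] ⧸ I_t(M)` is FLAT over `O`: a lifted Hilbert–Burch matrix is
a flat deformation of the reduced determinantal scheme `V(I_t(M̄))`. [folklore, cf. Eisenbud GTM 150 §20]
[OURS · L1 W4.5b] -/
theorem flat_mvPolynomial_quotient_span_minor [IsDomain O] [IsDiscreteValuationRing O] {ϖ : O}
    (hϖ : Irreducible ϖ) (π : O →+* k) (hπ : Function.Surjective π) (hπϖ : π ϖ = 0)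
    (hker : ∀ r : O, π r = 0 → r ∈ Ideal.span {ϖ}) (M : Matrix (Fin (t + 1)) (Fin t) (MvPolynomial σ O))
    (hex : ∀ c : Fin (t + 1) → MvPolynomial σ k,
      (Matrix.of fun i =>
          (Fin.snoc ((M.map (MvPolynomial.map π)) i) (c i) : Fin (t + 1) → MvPolynomial σ k)).det = 0 →
        ∃ w : Fin t → MvPolynomial σ k, (M.map (MvPolynomial.map π)) *ᵥ w = c) :
    Module.Flat O
      (MvPolynomial σ O ⧸ Ideal.span (Set.range fun i : Fin (t + 1) => (M.submatrix i.succAbove id).det)) := by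
  haveI := isTorsionFree_mvPolynomial_quotient_span_minor hϖ π hπ hπϖ hker M hex
  infer_instance

/-- **THE v6′ RING CORE IN CHAIN CURRENCY (flatness from a regular pair downstairs).** `O` a DVR with uniformizer `ϖ`,
`π : O ↠ k` with `ker π ⊆ (ϖ)`, `π ϖ = 0`; `M` over `O[x_σ]` with reduction `M̄`; if `I_t(M̄) ⊂ k[x_σ]` contains `a, b`
with `a` a non-zero-divisor and `b` a non-zero-divisor modulo `a` (grade `I_t(M̄) ≥ 2`, e.g. `M̄` the Hilbert–Burch
matrix of an ACM curve in `ℙ³_k`), then `O[x_σ] ⧸ I_t(M)` is flat over `O`. [Eisenbud GTM 150 Thm. 20.15 + §20;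
elementary proof OURS] [OURS · L1 W4.5b] -/
theorem flat_mvPolynomial_quotient_span_minor_of_regular_pair [IsDomain O] [IsDiscreteValuationRing O] {ϖ : O}
    (hϖ : Irreducible ϖ) (π : O →+* k) (hπ : Function.Surjective π) (hπϖ : π ϖ = 0)
    (hker : ∀ r : O, π r = 0 → r ∈ Ideal.span {ϖ}) (M : Matrix (Fin (t + 1)) (Fin t) (MvPolynomial σ O))
    {a b : MvPolynomial σ k}
    (haI : a ∈ Ideal.span (Set.range fun i : Fin (t + 1) =>
      ((M.map (MvPolynomial.map π)).submatrix i.succAbove id).det))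
    (hbI : b ∈ Ideal.span (Set.range fun i : Fin (t + 1) =>
      ((M.map (MvPolynomial.map π)).submatrix i.succAbove id).det))
    (ha : a ∈ nonZeroDivisors (MvPolynomial σ k))
    (hb : ∀ y : MvPolynomial σ k, b * y ∈ Ideal.span {a} → y ∈ Ideal.span {a}) :
    Module.Flat O
      (MvPolynomial σ O ⧸ Ideal.span (Set.range fun i : Fin (t + 1) => (M.submatrix i.succAbove id).det)) :=
  flat_mvPolynomial_quotient_span_minor hϖ π hπ hπϖ hker M
    (fun c hc => exists_mulVec_eq_of_det_snoc_eq_zero (M.map (MvPolynomial.map π)) haI hbI ha hb c hc)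

/-- **Special fibre in chain currency**: the reduction of the ideal of maximal minors is the ideal of maximal minors of
the reduction, `(I_t M).map (map π) = I_t(M.map (map π))`, so `(O[x_σ] ⧸ I_t M) ⊗_O k = k[x_σ] ⧸ I_t(M̄)` for a model
`π` with `ker (map π) = (C ϖ)`. [folklore] [OURS · L1 W4.5b] -/
theorem map_span_minor_mvPolynomial (π : O →+* k) (M : Matrix (Fin (t + 1)) (Fin t) (MvPolynomial σ O)) :
    (Ideal.span (Set.range fun i : Fin (t + 1) => (M.submatrix i.succAbove id).det)).map (MvPolynomial.map π) =
      Ideal.span (Set.range fun i : Fin (t + 1) => ((M.map (MvPolynomial.map π)).submatrix i.succAbove id).det) :=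
  map_span_minor (MvPolynomial.map π) M

/-- For a residue model `π : O ↠ k` with `ker π = (ϖ)`, the kernel of `A = O[x_σ] ↠ k[x_σ] ⧸ I_t(M̄)` is
`I_t(M) + (C ϖ)`: the special fibre of `O[x_σ] ⧸ I_t(M)` at `ϖ` is `k[x_σ] ⧸ I_t(M̄)`. [folklore] [OURS · L1 W4.5b] -/
theorem comap_span_minor_mvPolynomial (π : O →+* k) (hπ : Function.Surjective π) {ϖ : O}
    (hkerπ : RingHom.ker π = Ideal.span {ϖ}) (M : Matrix (Fin (t + 1)) (Fin t) (MvPolynomial σ O)) :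
    (Ideal.span (Set.range fun i : Fin (t + 1) =>
        ((M.map (MvPolynomial.map π)).submatrix i.succAbove id).det)).comap (MvPolynomial.map π) =
      Ideal.span (Set.range fun i : Fin (t + 1) => (M.submatrix i.succAbove id).det) ⊔
        Ideal.span {(C ϖ : MvPolynomial σ O)} := by
  rw [comap_span_minor_map (MvPolynomial.map π) (MvPolynomial.map_surjective π hπ), MvPolynomial.ker_map, hkerπ,
    Ideal.map_span, Set.image_singleton]

/-- Every matrix over `k[x_σ]` lifts to `O[x_σ]` along a surjective `π : O ↠ k`. [folklore] [OURS · L1 W4.5b] -/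
theorem exists_matrix_map_mvPolynomial_eq (π : O →+* k) (hπ : Function.Surjective π) {m n : Type*}
    (N : Matrix m n (MvPolynomial σ k)) :
    ∃ M : Matrix m n (MvPolynomial σ O), M.map (MvPolynomial.map π) = N :=
  exists_matrix_map_eq_of_surjective (MvPolynomial.map π) (MvPolynomial.map_surjective π hπ) N

end Polynomial

end Summit.ResolutionOfSingularities.ResolutionOfSingularities.Cruxes.EquisingularLiftNat.Sections
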